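import Summits.NavierStokesRegularity.FluidComputer.GateBudgetLadderStepSharp
import Summits.NavierStokesRegularity.FluidComputer.GateBudgetCleanHorizon
import HarnessLib

/-!
# GateBudget part 127 — the θ-priced rung, IV: the swing ladder as a run, and the clean run of
# the headline member with `u = 1.662/K⁹` (§330–§331)

Cell `pub-fluidc`, blueprint seat bp1 (gen 42; SPEC-INPUT-bp1 §CR(3)(b), §CS);
namespace `Summit.NavierStokesRegularity.FluidComputer.GateBudget`, headline member
`RotorKnob.rotorCircuit K K¹⁰ ε ρ` from `delayInit`, `K ≥ 16`, unit lattice `ε = K¹⁰ρ²`.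
HONEST FRAMING: a low prior, high value-of-information experiment on Tao's machine paradigm;
NOT a claim that NS blows up. Nothing here is about the Navier–Stokes equations: these are
inequalities about the five-mode toy circuit (5.5)/(5.6).

* §330 `swingRung_anchor` — the anchor rung of `SwingRung` at index `1` is `(r₀, θ₀)` itself
  (part 107 §289's base case, on the definition; `U ≥ 0`, `δ ≥ 0` generic).
* §330 `knob_ladder_run_sharp` — THE θ-PRICED LADDER AS A RUN: part 118 §311 with part 126's
  step (`hU : 1.437 + 0.224 + 3.05(D + D²) + 511 log K·D² ≤ U`, `1 + γ ≤ U`, slip booked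
  against `(1 + γ)δ/2`); invariant, read-out and dependent choice are part 117/118's, unchanged.
* §331 `clean_ledger_numerics_sharp` — the four numbers of the θ-priced ledger at `K ≥ 16`,
  `D = 7/K⁴`: `U = 1.662` is admissible; the log coefficient `(141/5)(1000/831)/K⁴ ≤ 34/K⁴`;
  the slip parameter `1.2·(1000/831)/K⁹ ≤ 2/K⁹`; the window `(7/K⁴ + 0.1409)² + 10⁻⁴ + 2/K⁹
  ≤ 1/50`.
* §331 `knob_clean_run_sharp` — THE CLEAN RUN, θ-PRICED: part 118 §312 with the √-window
  `(N - 1)·1.662/K⁹ + 34 log N/K⁴ ≤ 0.1409` in place of `(N - 1)·2/K⁹ + 28.2 log N/K⁴ ≤ 0.1409`.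

WHAT THIS SAYS (and does not). The per-rung output price of the `k = 1` ladder is `1.662/K⁹`,
not `2/K⁹`, once the rung's own clock floor `θ ≥ 1.365` (forced by the capped-square invariant)
is fed into the swing price (parts 124/125/126); the clean run therefore extends to
`N - 1 ≈ 0.076K⁹` (part 128: `0.076K⁹ ≤ cleanHorizon`, against part 118's `0.065K⁹` and the
ceiling `0.1132K⁹ + 1` of part 119). HONEST LIMITS: (i) `k = 1`; (ii) the log coefficient grows
by the factor `1000/831` (the price of keeping `SwingRung` verbatim), costing `≈ 0.002K⁹` of
floor at `K = 16`; (iii) nothing about NS.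
[cite: Tao2016AveragedNS, §5.5 Theorem 5.3, (5.5), (b-eq), (c-eq), (d-eq), (energy-con)]
-/

noncomputable section

namespace Summit.NavierStokesRegularity.FluidComputer.GateBudget

open Real Set Filter Topology
open Literature.Analysis.FluidPDE.Tao2016AveragedNS

variable {K M ε ρ : ℝ} {X : ℝ → Fin 5 → ℝ} {C : ℝ → ℝ}

/-! ## §330 The θ-priced swing ladder as a run -/

/-- §330 THE ANCHOR RUNG: under the anchor data of part 107 §289 (`b(r₀) = θ₀ε`,
`1.39 - L ≤ θ₀ ≤ 29/20`, `c(r₀) = ρ²/K⁹`, `P(r₀) ≤ P₁`, `0 ≤ A₀ ≤ ã(r₀)`, `|d(r₀)| ≤ D₀`, the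
ledgers `D`, `L ≤ 42/K⁹`, any `U ≥ 0`, `δ ≥ 0`, the window at `N ≥ 1`), `(r₀, θ₀)` is a rung of
index `1`: `SwingRung … U δ L 1 r₀ θ₀`. Part 107 §289's base case, verbatim, on part 117 §309's
definition. [derived: part 107 §289 (base case), part 93 (`capped_step_out_band`), part 96
(`sqrt_pair_cap`), part 95 (`sharp_clock_signs`)] -/
theorem swingRung_anchor (hK : 16 ≤ K) (k : ℕ) {r₀ θ₀ P₁ A₀ D₀ D U δ L : ℝ} {N : ℕ}
    (hb₀ : X r₀ 1 = θ₀ * ε) (hc₀ : X r₀ 2 = ρ ^ 2 / K ^ 9)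
    (hP₁ : X r₀ 3 ^ 2 + X r₀ 4 ^ 2 ≤ P₁) (hθ₀lo : 139 / 100 - L ≤ θ₀) (hθ₀hi : θ₀ ≤ 29 / 20)
    (hL42 : L ≤ 42 / K ^ 9) (hA0 : 0 ≤ A₀) (hA₀ : A₀ ≤ X r₀ 4) (hD₀ : |X r₀ 3| ≤ D₀)
    (hD : D₀ + (1 + 10 / 9 * K ^ 4) * ((61 / 12 * k + 2 / 3) / K ^ 10 + 3 / K ^ 9) ≤ D)
    (hU0 : 0 ≤ U) (hδpos : 0 ≤ δ)
    (hL : 242 * log K / K ^ 10 + 37 * (D + (2 * k + 3) / (5 * K ^ 9) + 4 / K ^ 9) / K ^ 9 ≤ L)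
    (hNW : (√P₁ + ((N : ℝ) - 1) * (U / K ^ 9) + δ * K ^ 9 / 2 * log N) ^ 2
      + (3 * (k * π / ((25 / 16 - 1 / 10 ^ 6) * K ^ 10 - 1) + 1 / K ^ 19
      + 310 * log K / K ^ 9) / 10 + 6 / K ^ 9) + δ ≤ 1 / 50) (hN1 : 1 ≤ N) :
    SwingRung K ε ρ X k r₀ P₁ A₀ D₀ U δ L 1 r₀ θ₀ := by
  have hK0 : (0 : ℝ) < K := by linarith
  have hK9 : (0 : ℝ) < K ^ 9 := by positivity
  have hN1' : (1 : ℝ) ≤ N := by exact_mod_cast hN1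
  have hJ0 : (0 : ℝ) ≤ (61 / 12 * k + 2 / 3) / K ^ 10 + 3 / K ^ 9 := by positivity
  have hDnn : 0 ≤ D := by
    have : 0 ≤ (1 + 10 / 9 * K ^ 4) * ((61 / 12 * k + 2 / 3) / K ^ 10 + 3 / K ^ 9) := by
      positivity
    linarith only [le_trans (abs_nonneg _) hD₀, this, hD]
  obtain ⟨-, -, -, hl0⟩ := sharp_clock_signs hK hDnn
    (by positivity : (0 : ℝ) ≤ (2 * k + 3) / (5 * K ^ 9)) hL
  have hLs : L ≤ 1 / 10 ^ 6 := by
    have hK9' : (16 : ℝ) ^ 9 ≤ K ^ 9 := pow_le_pow_left₀ (by norm_num) hK 9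
    have h1 : 42 / K ^ 9 ≤ 42 / 16 ^ 9 :=
      div_le_div_of_nonneg_left (by norm_num) (by norm_num) hK9'
    norm_num at h1
    linarith only [hL42, h1]
  have hA723 : (0 : ℝ) ≤ 723 * log K / K ^ 10 :=
    div_nonneg (mul_nonneg (by norm_num) (Real.log_nonneg (by linarith))) (by positivity)
  have he₀ : 0 ≤ X r₀ 4 := hA0.trans hA₀
  have hF0 : 0 ≤ (723 * log K / K ^ 10 + 1972 / 1000) * X r₀ 4 ^ 2
      + (3 + 1 / 10 ^ 6) * X r₀ 4 / K :=
    add_nonneg (mul_nonneg (by linarith only [hA723]) (sq_nonneg _))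
      (div_nonneg (mul_nonneg (by norm_num) he₀) hK0.le)
  have hinv₀ := capped_step_out_band hl0 (by linarith only [hLs]) hθ₀lo hF0
  have hsq₀ : √(X r₀ 3 ^ 2 + X r₀ 4 ^ 2) ≤ √P₁ := Real.sqrt_le_sqrt hP₁
  have hW1 : √P₁ ≤ √P₁ + ((N : ℝ) - 1) * (U / K ^ 9) + δ * K ^ 9 / 2 * log N := by
    have h1 : 0 ≤ ((N : ℝ) - 1) * (U / K ^ 9) :=
      mul_nonneg (by linarith only [hN1']) (div_nonneg hU0 hK9.le)
    have h2 : 0 ≤ δ * K ^ 9 / 2 * log N := mul_nonneg (by positivity) (Real.log_nonneg hN1')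
    linarith only [h1, h2]
  have hcap := sqrt_pair_cap (by positivity) hsq₀ hW1
  unfold SwingRung
  refine ⟨by simp, hb₀, by linarith only [hθ₀lo, hLs], hθ₀hi, hc₀, ?_, ?_,
    by simpa using hA₀, by simpa using hD₀, ?_, ?_⟩
  · simp only [Nat.cast_one, sub_self, zero_mul, Real.log_one, mul_zero, add_zero]; exact hsq₀
  · linarith only [hcap, hNW, hδpos]
  · have : 0 ≤ (1 + 10 / 9 * K ^ 8) * ((61 / 12 * k + 2 / 3) / K ^ 10 + 3 / K ^ 9) :=
      mul_nonneg (by positivity) hJ0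
    simp only [Nat.cast_one, div_one]; linarith only [hD₀, this]
  · simp only [Nat.cast_one, sub_self, zero_mul, add_zero]; exact hinv₀

/-- §330 **THE θ-PRICED SWING LADDER AS A RUN** (part 126's hypotheses and the anchor's `hb₀`,
`hc₀`, `hθ₀lo`, `hθ₀hi`, `hA₀`, and `1 ≤ N`): there are SEQUENCES `r θ : ℕ → ℝ` with
`SwingRung … (n + 1) (r n) (θ n)` for every `n + 1 ≤ N` and `r (n + 1) ≥ r n + 1` — the first
rung is the anchor (`swingRung_anchor`), each next one is part 126 §329's step (dependent
choice, part 118 §311 `run_of_step`); past the window the sequence is continued by `r + 1` (no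
claim there). Part 118 §311 `knob_ladder_run_swing`, verbatim but for `hU`,
`hU2 ↦ (hγ0, hγ1, hUγ)`, `hδ`. [derived: part 126 §329, part 118 §311, this file
`swingRung_anchor`] -/
theorem knob_ladder_run_sharp
    (hX : ∀ t, HasDerivAt X (RotorKnob.rotorCircuit K (K ^ 10) ε ρ (X t)) t)
    (h0 : X 0 = delayInit) (hC : ∀ t, HasDerivAt C (X t 2) t) (hK : 16 ≤ K)
    (hε : 0 < ε) (hεK : ε ^ 2 ≤ 1 / (6 * K ^ 20)) (hρ : 0 < ρ)
    (hlo : 200 * ε / K ^ 20 ≤ ρ ^ 2) (hhi : K ^ 10 * ρ ^ 2 ≤ 2 * ε) (k : ℕ)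
    (hk : ε = k * K ^ 10 * ρ ^ 2) (hkone : k = 1) {r₀ θ₀ P₁ A₀ D₀ D U δ L γ : ℝ} {N : ℕ}
    (hr₀ : 0 ≤ r₀) (hb₀ : X r₀ 1 = θ₀ * ε) (hc₀ : X r₀ 2 = ρ ^ 2 / K ^ 9)
    (hP₁ : X r₀ 3 ^ 2 + X r₀ 4 ^ 2 ≤ P₁) (hθ₀lo : 139 / 100 - L ≤ θ₀) (hθ₀hi : θ₀ ≤ 29 / 20)
    (hL42 : L ≤ 42 / K ^ 9) (hN9 : (N : ℝ) - 1 ≤ K ^ 9)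
    (hA0 : 0 ≤ A₀) (hA₀ : A₀ ≤ X r₀ 4) (hD₀ : |X r₀ 3| ≤ D₀)
    (hD : D₀ + (1 + 10 / 9 * K ^ 4) * ((61 / 12 * k + 2 / 3) / K ^ 10 + 3 / K ^ 9) ≤ D)
    (hU : 1437 / 1000 + 224 / 1000 + 305 / 100 * (D + D ^ 2) + 511 * log K * D ^ 2 ≤ U)
    (hγ0 : 0 < γ) (hγ1 : γ ≤ 1) (hUγ : 1 + γ ≤ U)
    (hδ : (2 * D + (2 * k + 3) / (5 * K ^ 9)) * ((2 * k + 3) / (5 * K ^ 9))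
      + 6 * (D + (2 * k + 3) / (5 * K ^ 9) + 3 / K ^ 9) / K ^ 9 ≤ (1 + γ) / 2 * δ)
    (hL : 242 * log K / K ^ 10 + 37 * (D + (2 * k + 3) / (5 * K ^ 9) + 4 / K ^ 9) / K ^ 9 ≤ L)
    (hNW : (√P₁ + ((N : ℝ) - 1) * (U / K ^ 9) + δ * K ^ 9 / 2 * log N) ^ 2
      + (3 * (k * π / ((25 / 16 - 1 / 10 ^ 6) * K ^ 10 - 1) + 1 / K ^ 19
      + 310 * log K / K ^ 9) / 10 + 6 / K ^ 9) + δ ≤ 1 / 50)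
    (hNpos : 1 ≤ N) :
    ∃ r θ : ℕ → ℝ,
      (∀ n : ℕ, n + 1 ≤ N → SwingRung K ε ρ X k r₀ P₁ A₀ D₀ U δ L (n + 1) (r n) (θ n)) ∧
      ∀ n : ℕ, r n + 1 ≤ r (n + 1) := by
  have hK0 : (0 : ℝ) < K := by linarith
  have hK9 : (0 : ℝ) < K ^ 9 := by positivity
  have h3 : (0 : ℝ) ≤ 3 / K ^ 9 := by positivity
  have hι0 : (0 : ℝ) ≤ (2 * k + 3) / (5 * K ^ 9) := by positivity
  have hDnn : 0 ≤ D := by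
    have : 0 ≤ (1 + 10 / 9 * K ^ 4) * ((61 / 12 * k + 2 / 3) / K ^ 10 + 3 / K ^ 9) := by
      positivity
    linarith only [le_trans (abs_nonneg _) hD₀, this, hD]
  have hcold6 : 0 ≤ 6 * (D + (2 * k + 3) / (5 * K ^ 9) + 3 / K ^ 9) / K ^ 9 :=
    div_nonneg (mul_nonneg (by norm_num) (by linarith only [hDnn, hι0, h3])) hK9.le
  have h2Dι : 0 ≤ (2 * D + (2 * k + 3) / (5 * K ^ 9)) * ((2 * k + 3) / (5 * K ^ 9)) :=
    mul_nonneg (by linarith only [hDnn, hι0]) hι0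
  have hδ2 : 0 ≤ (1 + γ) / 2 * δ := by linarith only [hδ, hcold6, h2Dι]
  have hδpos : 0 ≤ δ :=
    le_of_mul_le_mul_left (by linarith only [hδ2]) (by positivity : (0 : ℝ) < (1 + γ) / 2)
  have hU0 : 0 ≤ U := by linarith only [hUγ, hγ0]
  have h1 : SwingRung K ε ρ X k r₀ P₁ A₀ D₀ U δ L 1 r₀ θ₀ :=
    swingRung_anchor hK k hb₀ hc₀ hP₁ hθ₀lo hθ₀hi hL42 hA0 hA₀ hD₀ hD hU0 hδpos hL hNW hNpos
  have hstep : ∀ (n : ℕ) (p : ℝ × ℝ),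
      (n + 1 ≤ N → SwingRung K ε ρ X k r₀ P₁ A₀ D₀ U δ L (n + 1) p.1 p.2) → ∃ q : ℝ × ℝ,
        (n + 1 + 1 ≤ N → SwingRung K ε ρ X k r₀ P₁ A₀ D₀ U δ L (n + 1 + 1) q.1 q.2) ∧
          p.1 + 1 ≤ q.1 := by
    intro n p hp
    by_cases h : n + 2 ≤ N
    · obtain ⟨r', θ', hsep, hrung⟩ := knob_ladder_step_sharp hX h0 hC hK hε hεK hρ hlo hhi k hk
        hkone hr₀ hP₁ hL42 hN9 hA0 hD₀ hD hU hγ0 hγ1 hUγ hδ hL hNW (m := n + 1) (by omega)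
        (by omega) (hp (by omega))
      exact ⟨(r', θ'), fun _ => hrung, hsep⟩
    · exact ⟨(p.1 + 1, p.2), fun h' => absurd h' (by omega), le_rfl⟩
  obtain ⟨f, hf, hR⟩ := run_of_step
    (P := fun (n : ℕ) (p : ℝ × ℝ) =>
      n + 1 ≤ N → SwingRung K ε ρ X k r₀ P₁ A₀ D₀ U δ L (n + 1) p.1 p.2)
    (R := fun p q : ℝ × ℝ => p.1 + 1 ≤ q.1) (a := (r₀, θ₀)) (fun _ => h1) hstep
  exact ⟨fun n => (f n).1, fun n => (f n).2, fun n hn => hf n hn, fun n => hR n⟩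

/-! ## §331 The member's clean run at k = 1, θ-priced -/

/-- §331 THE NUMBERS OF THE θ-PRICED LEDGER (`K ≥ 16`, `D = 7/K⁴`): (i) `1.437 + 0.224 +
3.05(D + D²) + 511 log K·D² ≤ 1.662` (`≈ 1.66142` at `K = 16`; `log K ≤ K`); (ii) the log
coefficient `(141/5)(1000/831)/K⁴ ≤ 34/K⁴`; (iii) the slip parameter `1.2(1000/831)/K⁹ ≤ 2/K⁹`;
(iv) the window `(7/K⁴ + 0.1409)² + 10⁻⁴ + 2/K⁹ ≤ 1/50`. [numerics] -/
theorem clean_ledger_numerics_sharp (hK : 16 ≤ K) :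
    1437 / 1000 + 224 / 1000 + 305 / 100 * (7 / K ^ 4 + (7 / K ^ 4) ^ 2)
        + 511 * log K * (7 / K ^ 4) ^ 2 ≤ 1662 / 1000 ∧
      (14 * 1 + 127) / (5 * K ^ 4) * (1000 / 831) ≤ 34 / K ^ 4 ∧
      (11 / 10 + (1 : ℝ) ^ 2 / 10) / K ^ 9 * (1000 / 831) ≤ 2 / K ^ 9 ∧
      (7 / K ^ 4 + 1409 / 10000) ^ 2 + 1 / 10000 + 2 / K ^ 9 ≤ (1 : ℝ) / 50 := by
  have hK0 : (0 : ℝ) < K := by linarith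
  have hK4 : (16 : ℝ) ^ 4 ≤ K ^ 4 := pow_le_pow_left₀ (by norm_num) hK 4
  have hK7 : (16 : ℝ) ^ 7 ≤ K ^ 7 := pow_le_pow_left₀ (by norm_num) hK 7
  have hK9 : (16 : ℝ) ^ 9 ≤ K ^ 9 := pow_le_pow_left₀ (by norm_num) hK 9
  have hK4p : (0 : ℝ) < K ^ 4 := by positivity
  have hK9p : (0 : ℝ) < K ^ 9 := by positivity
  have hD : 7 / K ^ 4 ≤ 7 / 16 ^ 4 := div_le_div_of_nonneg_left (by norm_num) (by norm_num) hK4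
  have hD0 : (0 : ℝ) ≤ 7 / K ^ 4 := by positivity
  have hD2 : (7 / K ^ 4) ^ 2 ≤ (7 / 16 ^ 4) ^ 2 := pow_le_pow_left₀ hD0 hD 2
  have hlog : log K ≤ K := (Real.log_le_sub_one_of_pos hK0).trans (by linarith)
  have hL : 511 * log K * (7 / K ^ 4) ^ 2 ≤ 25039 / K ^ 7 := by
    have e : 511 * K * (7 / K ^ 4) ^ 2 = 25039 / K ^ 7 := by field_simp; ring
    rw [← e]
    exact mul_le_mul_of_nonneg_right (by linarith only [hlog]) (sq_nonneg _)
  have h7 : 25039 / K ^ 7 ≤ 25039 / 16 ^ 7 :=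
    div_le_div_of_nonneg_left (by norm_num) (by norm_num) hK7
  have h9 : 2 / K ^ 9 ≤ 2 / 16 ^ 9 := div_le_div_of_nonneg_left (by norm_num) (by norm_num) hK9
  refine ⟨?_, ?_, ?_, ?_⟩
  · norm_num at hD hD2 h7 ⊢
    linarith only [hD, hD2, hL, h7]
  · rw [show (14 * 1 + 127) / (5 * K ^ 4) * (1000 / 831) = (141000 / 4155 : ℝ) / K ^ 4 by
      field_simp; ring]
    exact div_le_div_of_nonneg_right (by norm_num) hK4p.le
  · rw [show (11 / 10 + (1 : ℝ) ^ 2 / 10) / K ^ 9 * (1000 / 831) = (1200 / 831 : ℝ) / K ^ 9 by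
      field_simp; ring]
    exact div_le_div_of_nonneg_right (by norm_num) hK9p.le
  · norm_num at hD hD2 h9 ⊢
    nlinarith only [hD, hD2, h9, hD0]

/-- §331 **THE CLEAN RUN OF THE HEADLINE MEMBER, k = 1, θ-PRICED** (from `delayInit` with a
trigger primitive `C`, `K ≥ 16`, `0 < ε`, `ε² ≤ 1/(6K²⁰)`, `0 < ρ`, `ε = kK¹⁰ρ²` with `k = 1`;
`1 ≤ N` in the √-window `(N - 1)·1.662/K⁹ + 34 log N/K⁴ ≤ 0.1409`): there is ONE run
`(rₙ, θₙ)_{n<N}` of normal-form ignitions — `rₙ > 1.8282 + (n + 1)`, `r_{n+1} ≥ rₙ + 1`,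
`b(rₙ) = θₙε` with `5/4 ≤ θₙ ≤ 29/20`, `c(rₙ) = ρ²/K⁹`,
`√P(rₙ) ≤ 7/K⁴ + n·1.662/K⁹ + 34 log(n + 1)/K⁴`, `P(rₙ) ≤ 1/50`, `n/K⁹ ≤ ã(rₙ) ≤ 0.1415`,
`|d(rₙ)| ≤ 7/K⁴` — part 118 §312 with `u = 1.662/K⁹` for `2/K⁹` (ledgers: `U = 1.662`,
`γ = 0.662`, slip parameter `δ = δ₀·1000/831` so that `(1 + γ)δ/2 = δ₀` is part 96's ã-free
slip, log coefficient `δK⁹/2 ≤ (141/5)(1000/831)/K⁴ ≤ 34/K⁴`). Plumbing verbatim.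
[derived: this file §330 and `clean_ledger_numerics_sharp`, part 118 §311–§312, part 83
§241–§242, part 96 §271, part 85 §250, part 89 §258, part 106 §288a] -/
theorem knob_clean_run_sharp
    (hX : ∀ t, HasDerivAt X (RotorKnob.rotorCircuit K (K ^ 10) ε ρ (X t)) t)
    (h0 : X 0 = delayInit) (hC : ∀ t, HasDerivAt C (X t 2) t) (hK : 16 ≤ K)
    (hε : 0 < ε) (hεK : ε ^ 2 ≤ 1 / (6 * K ^ 20)) (hρ : 0 < ρ) (k : ℕ)
    (hk : ε = k * K ^ 10 * ρ ^ 2) (hkone : k = 1) (N : ℕ) (hNpos : 1 ≤ N)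
    (hNW : ((N : ℝ) - 1) * (1662 / 1000 / K ^ 9) + 34 / K ^ 4 * log N ≤ 1409 / 10000) :
    ∃ r θ : ℕ → ℝ, (∀ n : ℕ, r n + 1 ≤ r (n + 1)) ∧ ∀ n : ℕ, n + 1 ≤ N →
      18282 / 10000 + ((n : ℝ) + 1) < r n ∧ X (r n) 1 = θ n * ε ∧
      5 / 4 ≤ θ n ∧ θ n ≤ 29 / 20 ∧ X (r n) 2 = ρ ^ 2 / K ^ 9 ∧
      √(X (r n) 3 ^ 2 + X (r n) 4 ^ 2)
        ≤ 7 / K ^ 4 + (n : ℝ) * (1662 / 1000 / K ^ 9) + 34 / K ^ 4 * log ((n : ℝ) + 1) ∧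
      X (r n) 3 ^ 2 + X (r n) 4 ^ 2 ≤ 1 / 50 ∧
      (n : ℝ) / K ^ 9 ≤ X (r n) 4 ∧ X (r n) 4 ≤ 1415 / 10000 ∧ |X (r n) 3| ≤ 7 / K ^ 4 := by
  have hkR : (k : ℝ) = 1 := by exact_mod_cast hkone
  have hlat : ε = K ^ 10 * ρ ^ 2 := by rw [hk, hkR, one_mul]
  obtain ⟨hlo, hhi, -, -, -, -, -⟩ := unit_lattice_numerics hK hlat
  have hkK : (k : ℝ) ≤ K ^ 2 := by rw [hkR]; nlinarith only [hK]
  obtain ⟨r₁, θ₁, hr1, hb1, hθlo, hθhi, hc1, he0, hP1, hd1, hk1⟩ :=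
    knob_ladder_anchor_member hX h0 hC hK hε hεK hρ hlo hhi k hk
  obtain ⟨hD, -, -, -, hres⟩ := two_sided_numerics hK hk1 hkK
  obtain ⟨hU, hcM', hδ2K, hwin'⟩ := clean_ledger_numerics_sharp hK
  have hS := clock_slip_numerics hK hk1 hkK
  obtain ⟨hL0, hL42⟩ := sharp_loss_numerics hK hk1 hkK
  obtain ⟨hcL, -⟩ := pair_ledger_numerics hK hk1 hkK
  have hK0 : (0 : ℝ) < K := by linarith
  have hK4 : (0 : ℝ) < K ^ 4 := by positivity
  have hK9 : (0 : ℝ) < K ^ 9 := by positivity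
  have hk0 : (0 : ℝ) ≤ k := Nat.cast_nonneg k
  obtain ⟨e₁, he₁_def⟩ : ∃ e₁ : ℝ,
      e₁ = k * π / (49 / 100 * K ^ 10 - 1) + 2 / K ^ 10 + 245 / K ^ 8 := ⟨_, rfl⟩
  obtain ⟨δ₀, hδ₀_def⟩ : ∃ δ₀ : ℝ,
      δ₀ = (2 * (7 / K ^ 4) + (2 * k + 3) / (5 * K ^ 9)) * ((2 * k + 3) / (5 * K ^ 9))
        + 6 * (7 / K ^ 4 + (2 * k + 3) / (5 * K ^ 9) + 3 / K ^ 9) / K ^ 9 := ⟨_, rfl⟩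
  obtain ⟨u, hu_def⟩ : ∃ u : ℝ, u = 1662 / 1000 / K ^ 9 := ⟨_, rfl⟩
  obtain ⟨cM, hcM_def⟩ : ∃ cM : ℝ, cM = 34 / K ^ 4 := ⟨_, rfl⟩
  obtain ⟨δ, hδ_def⟩ : ∃ δ : ℝ, δ = δ₀ * (1000 / 831) := ⟨_, rfl⟩
  rw [← he₁_def] at hP1 hd1 hD hres
  rw [← hδ₀_def] at hcL
  have hkR' : (k : ℝ) = 1 := by exact_mod_cast hkone
  have he₁0 : 0 ≤ e₁ := (abs_nonneg _).trans hd1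
  have hsq₁ : √(e₁ ^ 2) = e₁ := Real.sqrt_sq he₁0
  have he₁7 : e₁ ≤ 7 / K ^ 4 := by
    have hJ : 0 ≤ (1 + 10 / 9 * K ^ 4) * ((61 / 12 * k + 2 / 3) / K ^ 10 + 3 / K ^ 9) := by
      positivity
    linarith only [hD, hJ]
  have hu0 : 0 ≤ u := by rw [hu_def]; positivity
  have hδ₀0 : 0 ≤ δ₀ := by rw [hδ₀_def]; positivity
  have hδS : δ₀ ≤ (11 / 10 + k ^ 2 / 10) / K ^ 9 := by
    have h0 : 0 ≤ (2829 / 10000 + (7 / 2 + k ^ 2 / 3 + 1 / 1000) / K ^ 9)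
        * ((7 / 2 + k ^ 2 / 3 + 1 / 1000) / K ^ 9) := by positivity
    rw [hδ₀_def]; linarith only [hS, h0]
  have hcM0 : 0 ≤ cM := by rw [hcM_def]; positivity
  have hδ0' : 0 ≤ δ := by rw [hδ_def]; positivity
  -- the slip parameter `δ = δ₀·1000/831`: `δ ≤ 2/K⁹`, log coefficient `δK⁹/2 ≤ 34/K⁴ = cM`
  have hδK : δ ≤ 2 / K ^ 9 := by
    rw [hkR'] at hδS
    rw [hδ_def]
    exact (mul_le_mul_of_nonneg_right hδS (by norm_num)).trans hδ2K
  have hcL' : δ * K ^ 9 / 2 ≤ cM := by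
    rw [hkR'] at hcL
    rw [hδ_def, hcM_def]
    have h := mul_le_mul_of_nonneg_right hcL (by norm_num : (0 : ℝ) ≤ 1000 / 831)
    calc δ₀ * (1000 / 831) * K ^ 9 / 2 = δ₀ * K ^ 9 / 2 * (1000 / 831) := by ring
      _ ≤ (14 * 1 + 127) / (5 * K ^ 4) * (1000 / 831) := h
      _ ≤ 34 / K ^ 4 := hcM'
  have hδγ' : (2 * (7 / K ^ 4) + (2 * k + 3) / (5 * K ^ 9)) * ((2 * k + 3) / (5 * K ^ 9))
      + 6 * (7 / K ^ 4 + (2 * k + 3) / (5 * K ^ 9) + 3 / K ^ 9) / K ^ 9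
      ≤ (1 + 662 / 1000) / 2 * δ := by
    have e : (1 + 662 / 1000) / 2 * (δ₀ * (1000 / 831)) = δ₀ := by ring
    rw [hδ_def, e]
    exact le_of_eq hδ₀_def.symm
  have hθ₀lo : 139 / 100 - (242 * log K / K ^ 10
        + 37 * (7 / K ^ 4 + (2 * k + 3) / (5 * K ^ 9) + 4 / K ^ 9) / K ^ 9) ≤ θ₁ := by
    linarith only [hL0, hθlo]
  simp only [← hu_def, ← hcM_def] at hNW ⊢
  have hN1 : (1 : ℝ) ≤ N := by exact_mod_cast hNpos
  have hlogN : 0 ≤ log (N : ℝ) := Real.log_nonneg hN1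
  have hcMN : 0 ≤ cM * log N := mul_nonneg hcM0 hlogN
  -- `N - 1 ≤ K⁹` from the √-window: `1.662(N - 1) ≤ 0.1409K⁹`
  have hN9 : (N : ℝ) - 1 ≤ K ^ 9 := by
    have h : ((N : ℝ) - 1) * u ≤ 1409 / 10000 := by linarith only [hNW, hcMN]
    rw [hu_def, ← mul_div_assoc, div_le_iff₀ hK9] at h
    linarith only [h, hK9.le]
  -- the √-window of the run from the closed-form one
  have hcLN : δ * K ^ 9 / 2 * log N ≤ cM * log N := mul_le_mul_of_nonneg_right hcL' hlogN
  have hW0 : 0 ≤ √(e₁ ^ 2) + ((N : ℝ) - 1) * u + δ * K ^ 9 / 2 * log N := by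
    rw [hsq₁]
    have h1 : 0 ≤ ((N : ℝ) - 1) * u := mul_nonneg (by linarith only [hN1]) hu0
    have h2 : 0 ≤ δ * K ^ 9 / 2 * log N := mul_nonneg (by positivity) hlogN
    linarith only [he₁0, h1, h2]
  have hWle : √(e₁ ^ 2) + ((N : ℝ) - 1) * u + δ * K ^ 9 / 2 * log N
      ≤ 7 / K ^ 4 + 1409 / 10000 := by
    rw [hsq₁]; linarith only [he₁7, hNW, hcLN]
  have hW2 := pow_le_pow_left₀ hW0 hWle 2
  have hNW' : (√(e₁ ^ 2) + ((N : ℝ) - 1) * u + δ * K ^ 9 / 2 * log N) ^ 2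
      + (3 * (k * π / ((25 / 16 - 1 / 10 ^ 6) * K ^ 10 - 1) + 1 / K ^ 19
        + 310 * log K / K ^ 9) / 10 + 6 / K ^ 9) + δ ≤ 1 / 50 := by
    nlinarith only [hW2, hres, sq_nonneg e₁, hδK, hwin']
  obtain ⟨r, θ, hrun, hsep⟩ := knob_ladder_run_sharp hX h0 hC hK hε hεK hρ hlo hhi k hk hkone
    (γ := 662 / 1000) (le_of_lt (by linarith only [hr1])) hb1 hc1 hP1 hθ₀lo
    (by linarith only [hθhi]) hL42 hN9 le_rfl he0 hd1 hD hU (by norm_num) (by norm_num)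
    (by norm_num) hδγ' le_rfl (by rw [← hu_def]; exact hNW') hNpos
  refine ⟨r, θ, hsep, fun n hn => ?_⟩
  have hR := hrun n hn
  obtain ⟨hP, -, ha, hd⟩ := swingRung_readout (X := X) hK hε hρ hlo k hk le_rfl hD (by omega) hR
  unfold SwingRung at hR
  have en : ((n + 1 : ℕ) : ℝ) = n + 1 := Nat.cast_succ n
  have en1 : (n : ℝ) + 1 - 1 = n := by ring
  rw [en, en1] at hR
  obtain ⟨hr, hb, hθ1, hθ2, hc, hW, -, hA, -, -, -⟩ := hR
  have hn0 : (0 : ℝ) ≤ n := Nat.cast_nonneg n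
  have hlogn : 0 ≤ log ((n : ℝ) + 1) := Real.log_nonneg (by linarith only [hn0])
  have hcLn : δ * K ^ 9 / 2 * log ((n : ℝ) + 1) ≤ cM * log ((n : ℝ) + 1) :=
    mul_le_mul_of_nonneg_right hcL' hlogn
  refine ⟨by linarith only [hr, hr1], hb, hθ1, hθ2, hc, ?_, hP, by simpa using hA, ha, hd⟩
  rw [hsq₁, ← hu_def] at hW
  linarith only [hW, he₁7, hcLn]

end Summit.NavierStokesRegularity.FluidComputer.GateBudget

end
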